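import Mathlib.Analysis.SpecialFunctions.Pow.Real
import Summits.MatrixMultiplication.MatrixMultiplication.Theses.ThinBlockAlpha
import Literature.Computability.AlgebraicComplexity.GroupTheoreticMatMul
import Literature.Computability.AlgebraicComplexity.GroupTheoreticMatMulProofs
import Literature.Computability.AlgebraicComplexity.FlatteningBound

/-!
# `ThinBlockAlpha.ThinCertifiesOmega` (stmt-MatrixMultiplication-10938) — proved

Route `MatrixMultiplication/ThinBlockAlpha`, support item `ThinCertifiesOmega` (bookkeeping, square
form): a thin STPP family of `L` blocks `⟨N, M, N⟩` with `N ≥ 2`, `M ≥ N^a` (`0 ≤ a ≤ 1`) in a finite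
abelian group `H` with `|H| ≤ L·N^{2+η}` certifies `(2 + a)·ω(ℂ) ≤ 3(2 + η)`.

Proof (Cohn–Kleinberg–Szegedy–Umans 2005, Thm. 5.5, abelian case = Blasiak et al. 2017, (1.1) — the
DISCHARGED tree fact `CohnKleinbergSzegedyUmans2005_5_5_abelian_holds`): the fundamental inequality
reads `L·(N·M·N)^{ω/3} = Σᵢ (|Aᵢ||Bᵢ||Cᵢ|)^{ω/3} ≤ |H| ≤ L·N^{2+η}`; `L = 0` is impossible since
`|H| ≥ 1`, so `L` cancels; `N^{2+a} = N²·N^a ≤ N²·M = N·M·N` and `ω/3 ≥ 0` (`ω ≥ 2`,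
`omega_two_le`) give `N^{(2+a)·ω/3} ≤ N^{2+η}`, and `N ≥ 2 > 1` lets one compare exponents.
The hypotheses `0 ≤ a`, `a ≤ 1`, `0 < η` of the item are not needed for the inequality.

Imports only `GroupTheoreticMatMul(Proofs)` and `FlatteningBound` on the Literature side (the route's
repaired cone, rev 1): no `RectangularExponent*` / `TensorMultiples` module is touched, so no
undischarged named fact enters the cone of the route's deciding theorem.
-/

namespace Summit.MatrixMultiplication.MatrixMultiplication.Theorems

open scoped BigOperators
open Literature.Computability.AlgebraicComplexity

/-- **`ThinCertifiesOmega` holds** (route ThinBlockAlpha, stmt-MatrixMultiplication-10938): for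
`0 ≤ a ≤ 1`, `η > 0`, a finite abelian group `H` and an STPP family `(Aᵢ, Bᵢ, Cᵢ)_{i<L}` with
`|Aᵢ| = |Cᵢ| = N ≥ 2`, `|Bᵢ| = M ≥ N^a` and `|H| ≤ L·N^{2+η}`, one has `(2 + a)·ω(ℂ) ≤ 3(2 + η)`.
From CKSU 2005 Thm. 5.5 (abelian case; tree theorem `CohnKleinbergSzegedyUmans2005_5_5_abelian_holds`):
`L·(N²M)^{ω/3} ≤ |H| ≤ L·N^{2+η}`, `L ≥ 1` (as `|H| ≥ 1`), `N^{2+a} ≤ N²M`, monotonicity of real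
powers and comparison of exponents at base `N > 1`. [folklore] -/
theorem thinCertifiesOmega_proof :
    Summit.MatrixMultiplication.MatrixMultiplication.Theses.ThinBlockAlpha.ThinCertifiesOmega := by
  unfold Summit.MatrixMultiplication.MatrixMultiplication.Theses.ThinBlockAlpha.ThinCertifiesOmega
  intro a _ha0 _ha1 η _hη H _ _ L N M A B C hS hcard hN hM hH
  classical
  have hω3 : 0 ≤ omega ℂ / 3 := by
    have h2 : (2 : ℝ) ≤ omega ℂ := omega_two_le ℂ
    linarith
  -- CKSU 2005, Thm. 5.5 (abelian case): Σᵢ (|Aᵢ||Bᵢ||Cᵢ|)^{ω/3} ≤ |H|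
  have hck := CohnKleinbergSzegedyUmans2005_5_5_abelian_holds H L A B C hS
  -- all blocks have the one shape ⟨N, M, N⟩, so the sum is L·(N·M·N)^{ω/3}
  have hterm : ∀ i : Fin L, (((A i).card * (B i).card * (C i).card : ℕ) : ℝ) ^ (omega ℂ / 3)
      = ((N * M * N : ℕ) : ℝ) ^ (omega ℂ / 3) := by
    intro i
    obtain ⟨h1, h2, h3⟩ := hcard i
    rw [h1, h2, h3]
  rw [Finset.sum_congr rfl (fun i _ => hterm i), Finset.sum_const, Finset.card_univ,
    Fintype.card_fin, nsmul_eq_mul] at hck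
  -- |H| ≥ 1 forces L ≥ 1
  have hHpos : (0 : ℝ) < Fintype.card H := by exact_mod_cast Fintype.card_pos
  have hLpos : (0 : ℝ) < L := by
    rcases Nat.eq_zero_or_pos L with hL0 | hLp
    · exfalso
      rw [hL0, Nat.cast_zero, zero_mul] at hH
      linarith
    · exact_mod_cast hLp
  -- cancel L: (N·M·N)^{ω/3} ≤ N^{2+η}
  have hmain : ((N * M * N : ℕ) : ℝ) ^ (omega ℂ / 3) ≤ (N : ℝ) ^ (2 + η) :=
    le_of_mul_le_mul_left (hck.trans hH) hLpos
  have hNpos : (0 : ℝ) < N := by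
    have h : 0 < N := lt_of_lt_of_le Nat.zero_lt_two hN
    exact_mod_cast h
  have hN1 : (1 : ℝ) < N := by
    have h : 1 < N := lt_of_lt_of_le Nat.one_lt_two hN
    exact_mod_cast h
  have hN0 : (0 : ℝ) ≤ N := hNpos.le
  -- N^{2+a} = N²·N^a ≤ N²·M = N·M·N
  have hNa : (N : ℝ) ^ (2 + a) ≤ ((N * M * N : ℕ) : ℝ) := by
    calc (N : ℝ) ^ (2 + a) = (N : ℝ) ^ (2 : ℝ) * (N : ℝ) ^ a := Real.rpow_add hNpos 2 a
      _ = (N : ℝ) ^ 2 * (N : ℝ) ^ a := by rw [Real.rpow_two]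
      _ ≤ (N : ℝ) ^ 2 * M := mul_le_mul_of_nonneg_left hM (sq_nonneg _)
      _ = ((N * M * N : ℕ) : ℝ) := by push_cast; ring
  -- monotonicity of t ↦ t^{ω/3}, then rpow_mul and comparison of exponents at base N > 1
  have h1 : ((N : ℝ) ^ (2 + a)) ^ (omega ℂ / 3) ≤ (N : ℝ) ^ (2 + η) :=
    (Real.rpow_le_rpow (Real.rpow_nonneg hN0 _) hNa hω3).trans hmain
  rw [← Real.rpow_mul hN0, Real.rpow_le_rpow_left_iff hN1] at h1
  linarith [h1]

end Summit.MatrixMultiplication.MatrixMultiplication.Theorems
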